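import Summits.ValiantsHypothesis.ValiantsHypothesis.Theorems.KPlusLogSqLawTropicalBSplitGlue
import Summits.ValiantsHypothesis.ValiantsHypothesis.Theorems.KPlusLogSqLawTropicalExchange

/-!
# Route «KPlusLogSqLaw», crux `TropicalB` (stmt-ValiantsHypothesis-19771) — THE THREE-BODY ACTIVATION LAW: three single-token
# activations over a common dominant base are never re-assembled by TWO present terms (value level; the «free triangle» of
# exchange cycles is impossible)

HONEST FRAMING.  Helper toward the registered stubs `stub_tropThin` / `stub_tropFat` of `Cruxes/TropicalB/Lines/birth.lean` (crux
`Summit.ValiantsHypothesis.ValiantsHypothesis.Theses.KPlusLogSqLaw.TropicalB`, item stmt-ValiantsHypothesis-19771, route KPlusLogSqLaw;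
cell `pub-symmetroid`, seat val-sym-trop-p5 g25, refuter-adjacent lane, 2026-08-29; `--supports … --as helper`).  A STRUCTURE law about
unique optima (`IsDominant`) of an ARBITRARY dominance design `(d, v, ε)`; nothing here bounds `TropicalB`, and nothing bears on
`WeakLifting`, DoorA26 / DoorA34, `MatrixDescartes` (stmt-ValiantsHypothesis-18050) or VP ≠ VNP.

THE LAW (`ThreeBody.three_body_activation`).  Let `B` be the unique optimum at some slope `θB` (any) and `P₁, P₂, P₃` unique optima at
`θ₁ < θ₂ < θ₃` with slopes `s_B + δ_j`, `δ_j > 0` («three activations over the base `B`»).  Suppose two PRESENT terms `T₁, T₂`,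
none of them equal to `B, P₁, P₂, P₃`, RE-ASSEMBLE the three activations over the base:
  `V(T₁) + V(T₂) + V(B) = V(P₁) + V(P₂) + V(P₃)`  (valuation sums) and
  `slope T₁ = s_B + Σ_{j ∈ J} δ_j`, `slope T₂ = s_B + Σ_{j ∉ J} δ_j` for some `J ⊆ {1,2,3}` (the increments are DISTRIBUTED).
Then: contradiction.  (Gains over `B` are affine in `θ`; a tokenless re-assembly is beaten by `B` at `θB`, a one-token re-assembly by
the corresponding `P_j` at every `θ` (parallel lines), and the complementary member then undercuts the LATER of the two remaining
activations at its own slope, where both remaining gains are positive.)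

WHY (memo HOME/val-sym-trop-p5/g25/CONTACT-LAWS-g25.md §3).  In a radix-2 odometer the activations `M_{S+x}, M_{S+y}, M_{S+z}` of three
tokens over a state `M_S` are exchange CYCLES `Z_x, Z_y, Z_z` which pairwise meet (sunflower law, `…TropicalBDisjointDeviations`).  If the
three pairwise contacts are pairwise DISJOINT («free triangle»), the docking lemma (`Docking.docking` of `…TropicalBDockingLaw`, index
type `Fin 3`, `dock` = the cyclic shift resp. its inverse) re-assembles the arcs between consecutive contacts into two present terms
`ω = A_x A_y A_z` and `ω̄ = B_z B_y B_x` with exactly the column-wise bookkeeping assumed here (each token column lies on one arc of its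
cycle, so the increments are distributed).  Hence: THE THREE PAIRWISE CONTACTS OF THREE ACTIVATION CYCLES OVER A COMMON STATE ARE NEVER
PAIRWISE DISJOINT — some column is common to all three cycles.  With the parallel-contact law (`…TropicalBParallelContact`) this is the
exchange-calculus skeleton of the located «hub» phenomenology of the cell's binary counters (val-sym-trop-p5 g23 §3b: in the 6-cube s204
every single-token state sits on the hub cell `(1,1)`), and of the death of bit networks whose coupling graph has a cycle (trop-p1 g28).

[folklore ingredients (lower hulls, affine gains); the packaging is the cell's, no citation exists]
-/

set_option linter.dupNamespace false
set_option autoImplicit false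

namespace Summit.ValiantsHypothesis.ValiantsHypothesis.Theorems.KPlusLogSqLaw

namespace ThreeBody

open Summit.ValiantsHypothesis.ValiantsHypothesis.Theorems.MatrixDescartes.Negative
open Summit.ValiantsHypothesis.ValiantsHypothesis.Theorems.LacunarySymmetroidMatrixDescartes
open Finset
open scoped BigOperators

variable {m K : ℕ}

/-- **THREE-BODY ACTIVATION LAW** (value level).  See the module docstring.  `J` is given by three Booleans `b₁ b₂ b₃`
(`b_j = true` iff the increment `δ_j` of `P_j` over `B` goes to `T₁`). [this cell; folklore ingredients] -/
theorem three_body_activation (d : Fin K → ℕ) (v ε : Fin m → Fin m → Fin K → ℤ) {θB θ₁ θ₂ θ₃ : ℤ}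
    {B P₁ P₂ P₃ T₁ T₂ : Equiv.Perm (Fin m) × (Fin m → Fin K)}
    (hB : IsDominant d v ε θB B) (h₁ : IsDominant d v ε θ₁ P₁) (h₂ : IsDominant d v ε θ₂ P₂) (h₃ : IsDominant d v ε θ₃ P₃)
    (hθ₁₂ : θ₁ < θ₂) (hθ₂₃ : θ₂ < θ₃)
    (hδ₁ : TropicalCensus.slope d B < TropicalCensus.slope d P₁) (hδ₂ : TropicalCensus.slope d B < TropicalCensus.slope d P₂)
    (hδ₃ : TropicalCensus.slope d B < TropicalCensus.slope d P₃)
    (hT₁ : termSign ε T₁ ≠ 0) (hT₂ : termSign ε T₂ ≠ 0)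
    (hV : (∑ i, v (T₁.1 i) i (T₁.2 i)) + (∑ i, v (T₂.1 i) i (T₂.2 i)) + ∑ i, v (B.1 i) i (B.2 i) =
      (∑ i, v (P₁.1 i) i (P₁.2 i)) + (∑ i, v (P₂.1 i) i (P₂.2 i)) + ∑ i, v (P₃.1 i) i (P₃.2 i))
    (b₁ b₂ b₃ : Bool)
    (hs₁ : TropicalCensus.slope d T₁ = TropicalCensus.slope d B
      + (if b₁ then TropicalCensus.slope d P₁ - TropicalCensus.slope d B else 0)
      + (if b₂ then TropicalCensus.slope d P₂ - TropicalCensus.slope d B else 0)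
      + (if b₃ then TropicalCensus.slope d P₃ - TropicalCensus.slope d B else 0))
    (hs₂ : TropicalCensus.slope d T₂ = TropicalCensus.slope d B
      + (if b₁ then 0 else TropicalCensus.slope d P₁ - TropicalCensus.slope d B)
      + (if b₂ then 0 else TropicalCensus.slope d P₂ - TropicalCensus.slope d B)
      + (if b₃ then 0 else TropicalCensus.slope d P₃ - TropicalCensus.slope d B))
    (n₁B : T₁ ≠ B) (n₂B : T₂ ≠ B) (n₁₁ : T₁ ≠ P₁) (n₁₂ : T₁ ≠ P₂) (n₁₃ : T₁ ≠ P₃)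
    (n₂₁ : T₂ ≠ P₁) (n₂₂ : T₂ ≠ P₂) (n₂₃ : T₂ ≠ P₃) : False := by
  -- distinctness of the base from the activations
  have nB₁ : B ≠ P₁ := fun h => by rw [h] at hδ₁; exact lt_irrefl _ hδ₁
  have nB₂ : B ≠ P₂ := fun h => by rw [h] at hδ₂; exact lt_irrefl _ hδ₂
  have nB₃ : B ≠ P₃ := fun h => by rw [h] at hδ₃; exact lt_irrefl _ hδ₃
  -- the dominance inequalities, in the form `θ·slope − V`
  have eB₁ := hB.2 T₁ n₁B hT₁
  have eB₂ := hB.2 T₂ n₂B hT₂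
  have e₁₁ := h₁.2 T₁ n₁₁ hT₁
  have e₁₂ := h₂.2 T₁ n₁₂ hT₁
  have e₁₃ := h₃.2 T₁ n₁₃ hT₁
  have e₂₁ := h₁.2 T₂ n₂₁ hT₂
  have e₂₂ := h₂.2 T₂ n₂₂ hT₂
  have e₂₃ := h₃.2 T₂ n₂₃ hT₂
  have f₁ := h₁.2 B nB₁ hB.1
  have f₂ := h₂.2 B nB₂ hB.1
  have f₃ := h₃.2 B nB₃ hB.1
  simp only [TropicalCensus.tropWeight_eq_slope_sub] at eB₁ eB₂ e₁₁ e₁₂ e₁₃ e₂₁ e₂₂ e₂₃ f₁ f₂ f₃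
  set sB := TropicalCensus.slope d B
  set s₁ := TropicalCensus.slope d P₁
  set s₂ := TropicalCensus.slope d P₂
  set s₃ := TropicalCensus.slope d P₃
  set t₁ := TropicalCensus.slope d T₁
  set t₂ := TropicalCensus.slope d T₂
  set VB := ∑ i, v (B.1 i) i (B.2 i)
  set V₁ := ∑ i, v (P₁.1 i) i (P₁.2 i)
  set V₂ := ∑ i, v (P₂.1 i) i (P₂.2 i)
  set V₃ := ∑ i, v (P₃.1 i) i (P₃.2 i)
  set W₁ := ∑ i, v (T₁.1 i) i (T₁.2 i)
  set W₂ := ∑ i, v (T₂.1 i) i (T₂.2 i)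
  -- monotonicity of the activation gains in `θ` (products of nonnegative quantities)
  have m₁₂ : θ₁ * (s₁ - sB) ≤ θ₂ * (s₁ - sB) := mul_le_mul_of_nonneg_right (by linarith) (by linarith)
  have m₁₃ : θ₁ * (s₁ - sB) ≤ θ₃ * (s₁ - sB) := mul_le_mul_of_nonneg_right (by linarith) (by linarith)
  have m₂₃ : θ₂ * (s₂ - sB) ≤ θ₃ * (s₂ - sB) := mul_le_mul_of_nonneg_right (by linarith) (by linarith)
  -- the activations beat the base at their own slopes
  have g₁ : V₁ - VB < θ₁ * (s₁ - sB) := by linarith [f₁, (by ring : θ₁ * (s₁ - sB) = θ₁ * s₁ - θ₁ * sB)]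
  have g₂ : V₂ - VB < θ₂ * (s₂ - sB) := by linarith [f₂, (by ring : θ₂ * (s₂ - sB) = θ₂ * s₂ - θ₂ * sB)]
  cases b₁ <;> cases b₂ <;> cases b₃ <;> simp only [Bool.false_eq_true, ↓reduceIte, add_zero] at hs₁ hs₂
  · -- J = ∅ : `T₁` is tokenless, `T₂` carries all three increments
    have a1 : VB < W₁ := by rw [hs₁] at eB₁; linarith
    have h2 : θ₃ * t₂ = θ₃ * (s₁ - sB) + θ₃ * (s₂ - sB) + θ₃ * s₃ := by rw [hs₂]; ring
    linarith
  · -- J = {3} : `T₁ ∥ P₃`, `T₂` carries `δ₁ + δ₂`; compare `T₂` with `P₂` at `θ₂`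
    have h1 : θ₃ * t₁ = θ₃ * s₃ := by rw [hs₁]; ring
    have h2 : θ₂ * t₂ = θ₂ * (s₁ - sB) + θ₂ * s₂ := by rw [hs₂]; ring
    linarith
  · -- J = {2} : `T₁ ∥ P₂`, `T₂` carries `δ₁ + δ₃`; compare `T₂` with `P₃` at `θ₃`
    have h1 : θ₂ * t₁ = θ₂ * s₂ := by rw [hs₁]; ring
    have h2 : θ₃ * t₂ = θ₃ * (s₁ - sB) + θ₃ * s₃ := by rw [hs₂]; ring
    linarith
  · -- J = {2,3} : `T₂ ∥ P₁`, `T₁` carries `δ₂ + δ₃`; compare `T₁` with `P₃` at `θ₃`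
    have h1 : θ₁ * t₂ = θ₁ * s₁ := by rw [hs₂]; ring
    have h2 : θ₃ * t₁ = θ₃ * (s₂ - sB) + θ₃ * s₃ := by rw [hs₁]; ring
    linarith
  · -- J = {1} : `T₁ ∥ P₁`, `T₂` carries `δ₂ + δ₃`; compare `T₂` with `P₃` at `θ₃`
    have h1 : θ₁ * t₁ = θ₁ * s₁ := by rw [hs₁]; ring
    have h2 : θ₃ * t₂ = θ₃ * (s₂ - sB) + θ₃ * s₃ := by rw [hs₂]; ring
    linarith
  · -- J = {1,3} : `T₂ ∥ P₂`, `T₁` carries `δ₁ + δ₃`; compare `T₁` with `P₃` at `θ₃`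
    have h1 : θ₂ * t₂ = θ₂ * s₂ := by rw [hs₂]; ring
    have h2 : θ₃ * t₁ = θ₃ * (s₁ - sB) + θ₃ * s₃ := by rw [hs₁]; ring
    linarith
  · -- J = {1,2} : `T₂ ∥ P₃`, `T₁` carries `δ₁ + δ₂`; compare `T₁` with `P₂` at `θ₂`
    have h1 : θ₃ * t₂ = θ₃ * s₃ := by rw [hs₂]; ring
    have h2 : θ₂ * t₁ = θ₂ * (s₁ - sB) + θ₂ * s₂ := by rw [hs₁]; ring
    linarith
  · -- J = {1,2,3} : `T₂` is tokenless, `T₁` carries all three increments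
    have a1 : VB < W₂ := by rw [hs₂] at eB₂; linarith
    have h2 : θ₃ * t₁ = θ₃ * (s₁ - sB) + θ₃ * (s₂ - sB) + θ₃ * s₃ := by rw [hs₁]; ring
    linarith

end ThreeBody

end Summit.ValiantsHypothesis.ValiantsHypothesis.Theorems.KPlusLogSqLaw
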